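import Summits.CriticalPhenomena.Ising3DConformalLimit.Theses.ReflectionTwin
import HarnessLib

/-!
# Crux `ReflectionTwin.TwinTransparency` (stmt-CriticalPhenomena-16905) — negative-side support:
the ORDERING-THRESHOLD clause is load-bearing (the decoupled twin `J = 0` is opaque)

cdisprove cycle 1 (`refuter-cdisprove-stmt-CriticalPhenomena-16905-0`, 2026-08-17). THEOREM-ONLY structural
knowledge about the crux; no Theses statement is asserted positively.

The crux quantifies over seam couplings `J` with `IsSeamThreshold J := 0 < J ∧ ¬ LRO J ∧ ∀ J' > J, LRO J'`
(THE continuous plane-ordering threshold of the (111) reflection twin `TW(J)` at bulk `β_c(3)`). Weaken this to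
"a disordered seam", `0 ≤ J ∧ ¬ LRO J`, keeping everything else verbatim (`TwinTransparencyWithoutOrderThreshold`).
The weakened statement is FALSE for every admissible datum `(ρ, S)` (indeed for every `S` with `S₂ > 0`, whatever
`ρ`), witness `J = 0`:

* at `J = 0` every coupling of `TW(0)` touching the plane layer `h = 0` vanishes, so flipping all spins strictly
  above the plane is a symmetry of every free box; a cross-plane pair `σ_x σ_y` (`h x ≤ 0 < h y`) is odd under it,
  hence `⟨σ_x σ_y⟩_{TW(0), Λ_L} = 0` for every `L` and the sup over boxes is `0`
  (`twinBox_cross_eq_zero_of_seam_zero`, `twinLat_cross_eq_zero_of_seam_zero`);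
* the plane spins of `TW(0)` are isolated, so `⟨σ_0 σ_c⟩ = 0` for every plane site `c ≠ 0`: NO plane long-range
  order, `¬ LRO 0` (`not_LRO_seam_zero`) — `J = 0` satisfies the weakened hypothesis;
* the crux's conclusion at `J = 0` reads, for the continuum pair `(-n, +n)` (`n = e₀+e₁+e₂`), the lattice pair
  `(⌊-n/δ⌋, -⌊-n/δ⌋)` with heights `≤ -3` / `≥ 3`, so the renormalised twin correlator is `ρ(δ)² · 0 = 0` at every
  mesh, while the asserted limit `S₂(-n, A n)` is positive (`A n` lies above the plane by the side condition on
  `A`, `-n` below, so the read configuration is non-coincident and `IsNondegenerateTwoPoint` applies):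
  `conclusion_false_at_seam_zero` (needs ONLY `S₂ > 0`: no scaling-limit hypothesis, no sign of `ρ`).

Consequences: `twinTransparencyWithoutOrderThreshold_false_of_datum` (false as soon as one admissible datum
exists) and `…_false_of_existsContinuousLimit` (false under the route's own existence crux, stmt-4582). Reading for
provers: any proof of the crux must USE that `J` is the ordering threshold (`0 < J` or `∀ J' > J, LRO J'`), not merely
a coupling without plane order; by monotonicity the informative content sits in `∀ J' > J, LRO J'` (line
`replica-mirror` consumes it exactly once, in `stub_thresholdNotCut`: `slabChi J* = ⊤`; note `slabChi 0 < ⊤` as well,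
the slab of `TW(0)` being two decoupled ordinary surfaces plus free spins). Also recorded: at most one threshold
exists (`isSeamThresholdC_unique`, pure order logic).

References: S. Friedli, Y. Velenik, *Statistical Mechanics of Lattice Systems* (CUP 2017), §3.1 (free-boundary
pair-interaction boxes), §3.6 (spin-flip symmetry); the twin objects are the route's (`Theses/ReflectionTwin.lean`),
spelled as the closed terms of `Cruxes/TwinTransparency/Lines/replica_mirror.lean` §1 (byte-identical).
-/

noncomputable section

namespace Summit.CriticalPhenomena.Ising3DConformalLimit.Theorems.TwinTransparency.Negative

open scoped BigOperators Topology Classical InnerProductSpace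
open Filter Set Function
open Literature.Probability.LatticeModels

/-! ## §1 The crux objects as LOCAL NOTATIONS for the route's closed terms (no definitions in this file)

The notations expand to the byte-identical closed terms of `Cruxes/TwinTransparency/Lines/replica_mirror.lean` §1
(`twinBoxC`, `twinLatC`, `siteC`, `twinCorrC`, `LROC`, `thetaC`), so every statement below is about the crux's own
objects; `twinTransparency_iff` certifies this by `Iff.rfl` against the Theses decl. -/

set_option quotPrecheck false in
local notation "θ♭" => (fun v : EuclideanSpace ℝ (Fin 3) => ((ℝ ∙ (EuclideanSpace.single 0 1 + EuclideanSpace.single 1 1 + EuclideanSpace.single 2 1 : EuclideanSpace ℝ (Fin 3)))ᗮ).reflection v)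

set_option quotPrecheck false in
local notation "twinBox♭" => (fun (J : ℝ) (L : ℕ) (k : ℕ) (z : Fin k → Site 3) => PairIsing.gibbsAvg (fun a b : ↥(box 3 L) => if (((∑ i, |a.1 i - b.1 i| = 1) ∧ ¬ ((a.1 0 + a.1 1 + a.1 2 = 0 ∧ b.1 0 + b.1 1 + b.1 2 = 1) ∨ (a.1 0 + a.1 1 + a.1 2 = 1 ∧ b.1 0 + b.1 1 + b.1 2 = 0))) ∨ (((a.1 0 + a.1 1 + a.1 2 = 0 ∧ b.1 0 + b.1 1 + b.1 2 = 1) ∨ (a.1 0 + a.1 1 + a.1 2 = 1 ∧ b.1 0 + b.1 1 + b.1 2 = 0)) ∧ ∃ i : Fin 3, a.1 + b.1 = Pi.single i 1)) then (criticalBeta 3 / 2) * (if a.1 0 + a.1 1 + a.1 2 = 0 ∨ b.1 0 + b.1 1 + b.1 2 = 0 then J else 1) else 0) (fun s => ∏ i, if h : z i ∈ box 3 L then spinAt (⟨z i, h⟩ : ↥(box 3 L)) s else 0))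

set_option quotPrecheck false in
local notation "twinLat♭" => (fun (J : ℝ) (k : ℕ) (z : Fin k → Site 3) => ⨆ L : ℕ, PairIsing.gibbsAvg (fun a b : ↥(box 3 L) => if (((∑ i, |a.1 i - b.1 i| = 1) ∧ ¬ ((a.1 0 + a.1 1 + a.1 2 = 0 ∧ b.1 0 + b.1 1 + b.1 2 = 1) ∨ (a.1 0 + a.1 1 + a.1 2 = 1 ∧ b.1 0 + b.1 1 + b.1 2 = 0))) ∨ (((a.1 0 + a.1 1 + a.1 2 = 0 ∧ b.1 0 + b.1 1 + b.1 2 = 1) ∨ (a.1 0 + a.1 1 + a.1 2 = 1 ∧ b.1 0 + b.1 1 + b.1 2 = 0)) ∧ ∃ i : Fin 3, a.1 + b.1 = Pi.single i 1)) then (criticalBeta 3 / 2) * (if a.1 0 + a.1 1 + a.1 2 = 0 ∨ b.1 0 + b.1 1 + b.1 2 = 0 then J else 1) else 0) (fun s => ∏ i, if h : z i ∈ box 3 L then spinAt (⟨z i, h⟩ : ↥(box 3 L)) s else 0))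

set_option quotPrecheck false in
local notation "site♭" => (fun (δ : ℝ) (v : EuclideanSpace ℝ (Fin 3)) => if v 0 + v 1 + v 2 ≤ 0 then latticeApprox δ v else -latticeApprox δ ((fun v : EuclideanSpace ℝ (Fin 3) => ((ℝ ∙ (EuclideanSpace.single 0 1 + EuclideanSpace.single 1 1 + EuclideanSpace.single 2 1 : EuclideanSpace ℝ (Fin 3)))ᗮ).reflection v) v))

set_option quotPrecheck false in
local notation "twinCorr♭" => (fun (J δ : ℝ) (k : ℕ) (w : Fin k → EuclideanSpace ℝ (Fin 3)) => (fun (J : ℝ) (k : ℕ) (z : Fin k → Site 3) => ⨆ L : ℕ, PairIsing.gibbsAvg (fun a b : ↥(box 3 L) => if (((∑ i, |a.1 i - b.1 i| = 1) ∧ ¬ ((a.1 0 + a.1 1 + a.1 2 = 0 ∧ b.1 0 + b.1 1 + b.1 2 = 1) ∨ (a.1 0 + a.1 1 + a.1 2 = 1 ∧ b.1 0 + b.1 1 + b.1 2 = 0))) ∨ (((a.1 0 + a.1 1 + a.1 2 = 0 ∧ b.1 0 + b.1 1 + b.1 2 = 1) ∨ (a.1 0 + a.1 1 + a.1 2 =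 1 ∧ b.1 0 + b.1 1 + b.1 2 = 0)) ∧ ∃ i : Fin 3, a.1 + b.1 = Pi.single i 1)) then (criticalBeta 3 / 2) * (if a.1 0 + a.1 1 + a.1 2 = 0 ∨ b.1 0 + b.1 1 + b.1 2 = 0 then J else 1) else 0) (fun s => ∏ i, if h : z i ∈ box 3 L then spinAt (⟨z i, h⟩ : ↥(box 3 L)) s else 0)) J k (fun i => (fun (δ : ℝ) (v : EuclideanSpace ℝ (Fin 3)) => if v 0 + v 1 + v 2 ≤ 0 then latticeApprox δ v else -latticeApprox δ ((fun v : EuclideanSpace ℝ (Fin 3) => ((ℝ ∙ (EuclideanSpace.single 0 1 + EuclideanSpace.single 1 1 + EuclideanSpace.single 2 1 : EuclideanSpace ℝ (Fin 3)))ᗮ).reflection v) v)) δ (w i)))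

set_option quotPrecheck false in
local notation "LRO♭" => (fun J : ℝ => ∃ m : ℝ, 0 < m ∧ ∀ c : Site 3, c 0 + c 1 + c 2 = 0 → m ≤ (fun (J : ℝ) (k : ℕ) (z : Fin k → Site 3) => ⨆ L : ℕ, PairIsing.gibbsAvg (fun a b : ↥(box 3 L) => if (((∑ i, |a.1 i - b.1 i| = 1) ∧ ¬ ((a.1 0 + a.1 1 + a.1 2 = 0 ∧ b.1 0 + b.1 1 + b.1 2 = 1) ∨ (a.1 0 + a.1 1 + a.1 2 = 1 ∧ b.1 0 + b.1 1 + b.1 2 = 0))) ∨ (((a.1 0 + a.1 1 + a.1 2 = 0 ∧ b.1 0 + b.1 1 + b.1 2 = 1) ∨ (a.1 0 + a.1 1 + a.1 2 = 1 ∧ b.1 0 + b.1 1 + b.1 2 = 0)) ∧ ∃ i : Fin 3, a.1 + b.1 = Pi.single i 1)) then (criticalBeta 3 / 2) * (if a.1 0 + a.1 1 + a.1 2 = 0 ∨ b.1 0 + b.1 1 + b.1 2 = 0 then J else 1) else 0) (fun s => ∏ i, if h : z i ∈ box 3 L then spinAt (⟨z i, h⟩ : ↥(box 3 L)) s else 0))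 J 2 ![0, c])

set_option quotPrecheck false in
local notation "IsSeamThreshold♭" => (fun J : ℝ => 0 < J ∧ ¬ (fun J : ℝ => ∃ m : ℝ, 0 < m ∧ ∀ c : Site 3, c 0 + c 1 + c 2 = 0 → m ≤ (fun (J : ℝ) (k : ℕ) (z : Fin k → Site 3) => ⨆ L : ℕ, PairIsing.gibbsAvg (fun a b : ↥(box 3 L) => if (((∑ i, |a.1 i - b.1 i| = 1) ∧ ¬ ((a.1 0 + a.1 1 + a.1 2 = 0 ∧ b.1 0 + b.1 1 + b.1 2 = 1) ∨ (a.1 0 + a.1 1 + a.1 2 = 1 ∧ b.1 0 + b.1 1 + b.1 2 = 0))) ∨ (((a.1 0 + a.1 1 + a.1 2 = 0 ∧ b.1 0 + b.1 1 + b.1 2 = 1) ∨ (a.1 0 + a.1 1 + a.1 2 = 1 ∧ b.1 0 + b.1 1 + b.1 2 = 0)) ∧ ∃ i : Fin 3, a.1 + b.1 = Pi.single i 1)) then (criticalBeta 3 / 2) * (if a.1 0 + a.1 1 + a.1 2 = 0 ∨ b.1 0 + b.1 1 + b.1 2 = 0 then J else 1) else 0) (fun s => ∏ i, if h : z i ∈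 box 3 L then spinAt (⟨z i, h⟩ : ↥(box 3 L)) s else 0)) J 2 ![0, c]) J ∧ ∀ J' : ℝ, J < J' → (fun J : ℝ => ∃ m : ℝ, 0 < m ∧ ∀ c : Site 3, c 0 + c 1 + c 2 = 0 → m ≤ (fun (J : ℝ) (k : ℕ) (z : Fin k → Site 3) => ⨆ L : ℕ, PairIsing.gibbsAvg (fun a b : ↥(box 3 L) => if (((∑ i, |a.1 i - b.1 i| = 1) ∧ ¬ ((a.1 0 + a.1 1 + a.1 2 = 0 ∧ b.1 0 + b.1 1 + b.1 2 = 1) ∨ (a.1 0 + a.1 1 + a.1 2 = 1 ∧ b.1 0 + b.1 1 + b.1 2 = 0))) ∨ (((a.1 0 + a.1 1 + a.1 2 = 0 ∧ b.1 0 + b.1 1 + b.1 2 = 1) ∨ (a.1 0 + a.1 1 + a.1 2 = 1 ∧ b.1 0 + b.1 1 + b.1 2 = 0)) ∧ ∃ i : Fin 3, a.1 + b.1 = Pi.single i 1)) then (criticalBeta 3 / 2) * (if a.1 0 + a.1 1 + a.1 2 = 0 ∨ b.1 0 + b.1 1 + b.1 2 = 0 then J else 1) else 0) (fun s => ∏ i,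 if h : z i ∈ box 3 L then spinAt (⟨z i, h⟩ : ↥(box 3 L)) s else 0)) J 2 ![0, c]) J')

set_option quotPrecheck false in
local notation "n♭" => (EuclideanSpace.single 0 1 + EuclideanSpace.single 1 1 + EuclideanSpace.single 2 1 : EuclideanSpace ℝ (Fin 3))

/-- **Syntactic bridge**: the crux over the notations of this file, by `Iff.rfl`. [folklore] -/
theorem twinTransparency_iff :
    Summit.CriticalPhenomena.Ising3DConformalLimit.Theses.ReflectionTwin.TwinTransparency ↔
      ∀ (ρ : ℝ → ℝ) (S : CorrFamily 3), (∀ δ ∈ Set.Ioc (0:ℝ) 1, 0 < ρ δ) →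
        HasPointwiseScalingLimit (criticalCorr 3) ρ S → IsNondegenerateTwoPoint S →
        ∀ J : ℝ, IsSeamThreshold♭ J →
          ∃ A : EuclideanSpace ℝ (Fin 3) →ₗ[ℝ] EuclideanSpace ℝ (Fin 3), (∀ v, v 0 + v 1 + v 2 = 0 → A v = v) ∧ (∀ v, 0 < v 0 + v 1 + v 2 → 0 < A v 0 + A v 1 + A v 2) ∧
            ∀ k : ℕ, TendstoLocallyUniformlyOn (fun δ w => ρ δ ^ k * twinCorr♭ J δ k w)
              (fun w => S k (fun i => if w i 0 + w i 1 + w i 2 ≤ 0 then w i else A (w i))) (𝓝[>] (0:ℝ))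
              (NonCoincident 3 k ∩ {w | ∀ i, w i 0 + w i 1 + w i 2 ≠ 0}) :=
  Iff.rfl

/-- `IsSeamThreshold J ↔ 0 < J ∧ ¬ LRO J ∧ ∀ J' > J, LRO J'`. [folklore] -/
theorem isSeamThreshold_iff (J : ℝ) : IsSeamThreshold♭ J ↔ 0 < J ∧ ¬ LRO♭ J ∧ ∀ J' : ℝ, J < J' → LRO♭ J' := Iff.rfl

/-- At most one seam coupling is a threshold (no monotonicity needed). [folklore] -/
theorem isSeamThreshold_unique {J₁ J₂ : ℝ} (h₁ : IsSeamThreshold♭ J₁) (h₂ : IsSeamThreshold♭ J₂) :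
    J₁ = J₂ := by
  obtain ⟨-, hn₁, hup₁⟩ := h₁
  obtain ⟨-, hn₂, hup₂⟩ := h₂
  rcases lt_trichotomy J₁ J₂ with h | h | h
  · exact absurd (hup₁ J₂ h) hn₂
  · exact h
  · exact absurd (hup₂ J₁ h) hn₁

/-! ## §2 Partial spin flips and the decoupled twin -/

/-- A partial flip is an involution. [folklore] -/
theorem flipOn_flipOn {ι : Type*} (p : ι → Prop) [DecidablePred p] (s : SpinConfig ι) :
    (fun a => if p a then -((fun b => if p b then -s b else s b) a) else (fun b => if p b then -s b else s b) a) = s := by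
  funext a
  by_cases h : p a <;> simp [h]

/-- The real spin after a partial flip. [folklore] -/
theorem spinAt_flipOn {ι : Type*} (p : ι → Prop) [DecidablePred p] (s : SpinConfig ι) (a : ι) :
    spinAt a (fun b => if p b then -s b else s b) = if p a then -spinAt a s else spinAt a s := by
  by_cases h : p a <;> simp [spinAt, h, Units.val_neg]

/-- A partial flip across a CUT of the coupling graph (no coupling joins a flipped to an unflipped site)
preserves the Boltzmann weight. [folklore] -/
theorem gibbsWeight_flipOn {ι : Type*} [Fintype ι] [DecidableEq ι] (p : ι → Prop) [DecidablePred p]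
    (c : ι → ι → ℝ) (hc : ∀ a b, p a → ¬ p b → c a b = 0 ∧ c b a = 0) (s : SpinConfig ι) :
    PairIsing.gibbsWeight c (fun b => if p b then -s b else s b) = PairIsing.gibbsWeight c s := by
  unfold PairIsing.gibbsWeight
  congr 1
  refine Finset.sum_congr rfl fun a _ => Finset.sum_congr rfl fun b _ => ?_
  rw [spinAt_flipOn, spinAt_flipOn]
  by_cases ha : p a <;> by_cases hb : p b
  · simp [ha, hb]
  · simp [(hc a b ha hb).1]
  · simp [(hc b a hb ha).2]
  · simp [ha, hb]

/-- An observable ODD under a weight-preserving partial flip has Gibbs average zero. [folklore] -/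
theorem gibbsAvg_eq_zero_of_flipOn {ι : Type*} [Fintype ι] [DecidableEq ι] (p : ι → Prop) [DecidablePred p]
    (c : ι → ι → ℝ) (hc : ∀ a b, p a → ¬ p b → c a b = 0 ∧ c b a = 0) (f : SpinConfig ι → ℝ)
    (hf : ∀ s, f (fun b => if p b then -s b else s b) = -f s) : PairIsing.gibbsAvg c f = 0 := by
  rw [PairIsing.gibbsAvg_def]
  have hnum : ∑ s, f s * PairIsing.gibbsWeight c s = 0 := by
    set e : SpinConfig ι ≃ SpinConfig ι :=
      Function.Involutive.toPerm (fun s : SpinConfig ι => fun b => if p b then -s b else s b) (flipOn_flipOn p) with he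
    have h1 : ∑ s, f s * PairIsing.gibbsWeight c s = ∑ s, f (e s) * PairIsing.gibbsWeight c (e s) :=
      (Equiv.sum_comp e (fun s => f s * PairIsing.gibbsWeight c s)).symm
    have h2 : ∑ s, f (e s) * PairIsing.gibbsWeight c (e s) = -∑ s, f s * PairIsing.gibbsWeight c s := by
      rw [← Finset.sum_neg_distrib]
      refine Finset.sum_congr rfl fun s _ => ?_
      show f (fun b => if p b then -s b else s b) * PairIsing.gibbsWeight c (fun b => if p b then -s b else s b) =
        -(f s * PairIsing.gibbsWeight c s)
      rw [hf, gibbsWeight_flipOn p c hc, neg_mul]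
    linarith
  rw [hnum, zero_div]

/-- Height `h z = z₀ + z₁ + z₂` of adjacent twin sites differs by at most one. [folklore] -/
theorem abs_height_sub_le_of_adj {a b : Site 3}
    (h : ((∑ i, |a i - b i| = 1) ∧ ¬ ((a 0 + a 1 + a 2 = 0 ∧ b 0 + b 1 + b 2 = 1) ∨ (a 0 + a 1 + a 2 = 1 ∧ b 0 + b 1 + b 2 = 0))) ∨ (((a 0 + a 1 + a 2 = 0 ∧ b 0 + b 1 + b 2 = 1) ∨ (a 0 + a 1 + a 2 = 1 ∧ b 0 + b 1 + b 2 = 0)) ∧ ∃ i : Fin 3, a + b = Pi.single i 1)) :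
    |(a 0 + a 1 + a 2) - (b 0 + b 1 + b 2)| ≤ 1 := by
  rcases h with ⟨h1, -⟩ | ⟨h2, -⟩
  · have hs : (a 0 + a 1 + a 2) - (b 0 + b 1 + b 2) = ∑ i, (a i - b i) := by
      simp only [Fin.sum_univ_three]; ring
    rw [hs, ← h1]
    exact Finset.abs_sum_le_sum_abs _ _
  · rcases h2 with ⟨ha, hb⟩ | ⟨ha, hb⟩ <;> rw [ha, hb] <;> norm_num

/-- **The decoupled twin is opaque.** At seam coupling `J = 0` every free-box twin correlator `⟨σ_x σ_y⟩` with
`h x ≤ 0 < h y` vanishes identically: the couplings of `TW(0)` vanish on every bond touching the plane layer, so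
flipping all spins strictly above the plane is a symmetry under which `σ_x σ_y` is odd. [folklore] -/
theorem twinBox_cross_eq_zero_of_seam_zero (L : ℕ) (z : Fin 2 → Site 3)
    (h0 : z 0 0 + z 0 1 + z 0 2 ≤ 0) (h1 : 1 ≤ z 1 0 + z 1 1 + z 1 2) :
    twinBox♭ 0 L 2 z = 0 := by
  beta_reduce
  refine gibbsAvg_eq_zero_of_flipOn (fun a : ↥(box 3 L) => 1 ≤ a.1 0 + a.1 1 + a.1 2) _ ?_ _ ?_
  · intro a b ha hb
    constructor
    · split_ifs with hadj hpl
      · simp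
      · exfalso
        have := abs_height_sub_le_of_adj hadj
        rw [abs_le] at this
        push Not at hpl
        omega
      · rfl
    · split_ifs with hadj hpl
      · simp
      · exfalso
        have := abs_height_sub_le_of_adj hadj
        rw [abs_le] at this
        push Not at hpl
        omega
      · rfl
  · intro s
    simp only [Fin.prod_univ_two]
    have hz0 : ¬ (1 ≤ z 0 0 + z 0 1 + z 0 2) := by omega
    by_cases hm0 : z 0 ∈ box 3 L <;> by_cases hm1 : z 1 ∈ box 3 L <;>
      simp [hm0, hm1, spinAt_flipOn, hz0, h1]

/-- Hence the sup over boxes vanishes too: `twinLat 0 2 (x, y) = 0` for `h x ≤ 0 < h y`. [folklore] -/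
theorem twinLat_cross_eq_zero_of_seam_zero (z : Fin 2 → Site 3)
    (h0 : z 0 0 + z 0 1 + z 0 2 ≤ 0) (h1 : 1 ≤ z 1 0 + z 1 1 + z 1 2) :
    twinLat♭ 0 2 z = 0 := by
  have hL : ∀ L : ℕ, twinBox♭ 0 L 2 z = 0 := fun L => twinBox_cross_eq_zero_of_seam_zero L z h0 h1
  beta_reduce at hL ⊢
  exact le_antisymm (Real.iSup_le (fun L => (hL L).le) le_rfl) (Real.iSup_nonneg fun L => (hL L).ge)

/-- At `J = 0` the plane spins are isolated, so the plane two-point function `⟨σ_0 σ_c⟩` vanishes for every plane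
site `c ≠ 0` (flip the single spin at `c`). [folklore] -/
theorem twinBox_plane_eq_zero_of_seam_zero (L : ℕ) (c : Site 3) (hc : c 0 + c 1 + c 2 = 0) (hc0 : c ≠ 0) :
    twinBox♭ 0 L 2 ![0, c] = 0 := by
  beta_reduce
  refine gibbsAvg_eq_zero_of_flipOn (fun a : ↥(box 3 L) => a.1 = c) _ ?_ _ ?_
  · intro a b ha _
    have hpa : a.1 0 + a.1 1 + a.1 2 = 0 := by rw [ha]; exact hc
    constructor
    · split_ifs <;> simp_all
    · split_ifs <;> simp_all
  · intro s
    simp only [Fin.prod_univ_two, Matrix.cons_val_zero, Matrix.cons_val_one]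
    by_cases hm0 : (0 : Site 3) ∈ box 3 L <;> by_cases hm1 : c ∈ box 3 L <;>
      simp [hm0, hm1, spinAt_flipOn, hc0.symm]

/-- **No plane long-range order in the decoupled twin** (`¬ LRO 0`). [folklore] -/
theorem not_LRO_seam_zero : ¬ LRO♭ 0 := by
  rintro ⟨m, hm, h⟩
  have hc : (![1, -1, 0] : Site 3) 0 + (![1, -1, 0] : Site 3) 1 + (![1, -1, 0] : Site 3) 2 = 0 := by decide
  have hc0 : (![1, -1, 0] : Site 3) ≠ 0 := by
    intro h; have := congrFun h 0; simp at this
  have hle := h ![1, -1, 0] hc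
  have hzero : twinLat♭ 0 2 ![0, ![1, -1, 0]] = 0 := by
    have hL : ∀ L : ℕ, twinBox♭ 0 L 2 ![0, ![1, -1, 0]] = 0 :=
      fun L => twinBox_plane_eq_zero_of_seam_zero L _ hc hc0
    beta_reduce at hL ⊢
    exact le_antisymm (Real.iSup_le (fun L => (hL L).le) le_rfl) (Real.iSup_nonneg fun L => (hL L).ge)
  beta_reduce at hle hzero
  linarith


/-- Coordinates of `n`. [folklore] -/
theorem nrm_apply (i : Fin 3) : n♭ i = 1 := by
  fin_cases i <;> simp

/-- Coordinates of `-n`. [folklore] -/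
theorem neg_nrm_apply (i : Fin 3) : (-n♭) i = -1 := by
  rw [show (-n♭) i = -(n♭ i) from rfl, nrm_apply]

/-- `θ n = -n` (Mathlib `Submodule.reflection_orthogonalComplement_singleton_eq_neg`). [folklore] -/
theorem theta_nrm : θ♭ n♭ = -n♭ :=
  Submodule.reflection_orthogonalComplement_singleton_eq_neg n♭

/-- The copy-1 site of `-n` at mesh `δ > 0` lies strictly below the plane layer. [folklore] -/
theorem height_site_neg_nrm {δ : ℝ} (hδ : 0 < δ) :
    (site♭ δ (-n♭)) 0 + (site♭ δ (-n♭)) 1 + (site♭ δ (-n♭)) 2 ≤ 0 := by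
  have hle : (-n♭) 0 + (-n♭) 1 + (-n♭) 2 ≤ 0 := by simp only [neg_nrm_apply]; norm_num
  have hs : site♭ δ (-n♭) = latticeApprox δ (-n♭) := if_pos hle
  have hfl : ⌊(-1 : ℝ) / δ⌋ ≤ 0 := Int.floor_nonpos (div_nonpos_of_nonpos_of_nonneg (by norm_num) hδ.le)
  rw [hs]
  simp only [latticeApprox_apply, neg_nrm_apply]
  omega

/-- The copy-2 site of `+n` at mesh `δ > 0` lies strictly above the plane layer. [folklore] -/
theorem height_site_nrm {δ : ℝ} (hδ : 0 < δ) :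
    1 ≤ (site♭ δ n♭) 0 + (site♭ δ n♭) 1 + (site♭ δ n♭) 2 := by
  have hgt : ¬ (n♭ 0 + n♭ 1 + n♭ 2 ≤ 0) := by simp only [nrm_apply]; norm_num
  have hs : site♭ δ n♭ = -latticeApprox δ (θ♭ n♭) := if_neg hgt
  have hfl : ⌊(-1 : ℝ) / δ⌋ ≤ -1 := by
    rw [Int.floor_le_iff]; push_cast
    have : (-1 : ℝ) / δ < 0 := div_neg_of_neg_of_pos (by norm_num) hδ
    linarith
  rw [hs, theta_nrm]
  simp only [Pi.neg_apply, latticeApprox_apply, neg_nrm_apply]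
  omega

/-- **The conclusion of TT fails at seam coupling `J = 0` for EVERY datum with `S₂ > 0`** (no scaling-limit
hypothesis and no positivity of `ρ` needed): the cross-plane pair `(-n, +n)` reads the lattice pair `(z, -z)` with
`h z ≤ -3`, whose decoupled-twin correlator is identically `0` (`twinLat_cross_eq_zero_of_seam_zero`), while the
asserted limit `S₂(-n, A n)` is positive (`A n` lies above the plane, `-n` below, so the pair is non-coincident).
[folklore] -/
theorem conclusion_false_at_seam_zero (ρ : ℝ → ℝ) (S : CorrFamily 3) (hnd : IsNondegenerateTwoPoint S) :
    ¬ ∃ A : EuclideanSpace ℝ (Fin 3) →ₗ[ℝ] EuclideanSpace ℝ (Fin 3), (∀ v, v 0 + v 1 + v 2 = 0 → A v = v) ∧ (∀ v, 0 < v 0 + v 1 + v 2 → 0 < A v 0 + A v 1 + A v 2) ∧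
        ∀ k : ℕ, TendstoLocallyUniformlyOn (fun δ w => ρ δ ^ k * twinCorr♭ 0 δ k w)
          (fun w => S k (fun i => if w i 0 + w i 1 + w i 2 ≤ 0 then w i else A (w i))) (𝓝[>] (0:ℝ))
          (NonCoincident 3 k ∩ {w | ∀ i, w i 0 + w i 1 + w i 2 ≠ 0}) := by
  rintro ⟨A, -, hAup, hconv⟩
  have hsum_n : n♭ 0 + n♭ 1 + n♭ 2 = 3 := by simp only [nrm_apply]; norm_num
  have hsum_neg : (-n♭) 0 + (-n♭) 1 + (-n♭) 2 = -3 := by simp only [neg_nrm_apply]; norm_num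
  have hne : (-n♭ : EuclideanSpace ℝ (Fin 3)) ≠ n♭ := by
    intro h
    have := congrArg (fun v : EuclideanSpace ℝ (Fin 3) => v 0) h
    simp only [neg_nrm_apply, nrm_apply] at this
    norm_num at this
  set w : Fin 2 → EuclideanSpace ℝ (Fin 3) := ![-n♭, n♭] with hw
  have hw0 : w 0 = -n♭ := rfl
  have hw1 : w 1 = n♭ := rfl
  have hmem : w ∈ NonCoincident 3 2 ∩ {w | ∀ i, w i 0 + w i 1 + w i 2 ≠ 0} := by
    refine ⟨?_, ?_⟩
    · rw [mem_nonCoincident]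
      have h01 : w 0 ≠ w 1 := by rw [hw0, hw1]; exact hne
      intro i j hij
      fin_cases i <;> fin_cases j
      · rfl
      · exact absurd hij h01
      · exact absurd hij.symm h01
      · rfl
    · intro i
      fin_cases i
      · show w 0 0 + w 0 1 + w 0 2 ≠ 0
        rw [hw0, hsum_neg]; norm_num
      · show w 1 0 + w 1 1 + w 1 2 ≠ 0
        rw [hw1, hsum_n]; norm_num
  -- the twin correlator at `w` vanishes for every mesh `δ > 0`
  have hzero : ∀ δ : ℝ, 0 < δ → twinCorr♭ 0 δ 2 w = 0 := by
    intro δ hδ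
    show twinLat♭ 0 2 (fun i => site♭ δ (w i)) = 0
    refine twinLat_cross_eq_zero_of_seam_zero _ ?_ ?_
    · show (site♭ δ (w 0)) 0 + (site♭ δ (w 0)) 1 + (site♭ δ (w 0)) 2 ≤ 0
      rw [hw0]; exact height_site_neg_nrm hδ
    · show 1 ≤ (site♭ δ (w 1)) 0 + (site♭ δ (w 1)) 1 + (site♭ δ (w 1)) 2
      rw [hw1]; exact height_site_nrm hδ
  -- hence the asserted limit value is `0`
  have hlim := (hconv 2).tendsto_at hmem
  have hlim0 : Tendsto (fun _ : ℝ => (0:ℝ)) (𝓝[>] (0:ℝ))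
      (𝓝 (S 2 (fun i => if w i 0 + w i 1 + w i 2 ≤ 0 then w i else A (w i)))) := by
    refine hlim.congr' (eventually_nhdsWithin_of_forall fun δ hδ => ?_)
    show ρ δ ^ 2 * twinCorr♭ 0 δ 2 w = 0
    rw [hzero δ hδ, mul_zero]
  have hval : S 2 (fun i => if w i 0 + w i 1 + w i 2 ≤ 0 then w i else A (w i)) = 0 :=
    (tendsto_const_nhds_iff.mp hlim0).symm
  -- but the read configuration `(-n, A n)` is non-coincident, so `S₂ > 0` there
  have hcfg0 : (if w 0 0 + w 0 1 + w 0 2 ≤ 0 then w 0 else A (w 0)) = -n♭ := by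
    rw [hw0, if_pos (by rw [hsum_neg]; norm_num)]
  have hcfg1 : (if w 1 0 + w 1 1 + w 1 2 ≤ 0 then w 1 else A (w 1)) = A n♭ := by
    rw [hw1, if_neg (by rw [hsum_n]; norm_num)]
  have hAn : 0 < A n♭ 0 + A n♭ 1 + A n♭ 2 := hAup n♭ (by rw [hsum_n]; norm_num)
  have hne' : (-n♭ : EuclideanSpace ℝ (Fin 3)) ≠ A n♭ := by
    intro h
    rw [← h, hsum_neg] at hAn
    norm_num at hAn
  have hinj : (fun i => if w i 0 + w i 1 + w i 2 ≤ 0 then w i else A (w i)) ∈ NonCoincident 3 2 := by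
    rw [mem_nonCoincident]
    have h01 : (if w 0 0 + w 0 1 + w 0 2 ≤ 0 then w 0 else A (w 0)) ≠
        (if w 1 0 + w 1 1 + w 1 2 ≤ 0 then w 1 else A (w 1)) := by rw [hcfg0, hcfg1]; exact hne'
    intro i j hij
    fin_cases i <;> fin_cases j
    · rfl
    · exact absurd hij h01
    · exact absurd hij.symm h01
    · rfl
  exact absurd hval (hnd _ hinj).ne'

/-! ### The weakened crux `TwinTransparencyWithoutOrderThreshold♭` (a local notation, not a definition):
`IsSeamThreshold J` (`0 < J ∧ ¬LRO J ∧ ∀ J' > J, LRO J'`) replaced by `0 ≤ J ∧ ¬ LRO J`; everything else verbatim. -/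

set_option quotPrecheck false in
local notation "TwinTransparencyWithoutOrderThreshold♭" =>
  ∀ (ρ : ℝ → ℝ) (S : CorrFamily 3), (∀ δ ∈ Set.Ioc (0:ℝ) 1, 0 < ρ δ) →
    HasPointwiseScalingLimit (criticalCorr 3) ρ S → IsNondegenerateTwoPoint S →
    ∀ J : ℝ, (0 ≤ J ∧ ¬ LRO♭ J) →
      ∃ A : EuclideanSpace ℝ (Fin 3) →ₗ[ℝ] EuclideanSpace ℝ (Fin 3), (∀ v, v 0 + v 1 + v 2 = 0 → A v = v) ∧ (∀ v, 0 < v 0 + v 1 + v 2 → 0 < A v 0 + A v 1 + A v 2) ∧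
        ∀ k : ℕ, TendstoLocallyUniformlyOn (fun δ w => ρ δ ^ k * twinCorr♭ J δ k w)
          (fun w => S k (fun i => if w i 0 + w i 1 + w i 2 ≤ 0 then w i else A (w i))) (𝓝[>] (0:ℝ))
          (NonCoincident 3 k ∩ {w | ∀ i, w i 0 + w i 1 + w i 2 ≠ 0})

/-- **`_false_without_` lemma: the ordering threshold is load-bearing.** For every admissible datum the weakened
crux fails at the disordered coupling `J = 0`; in particular it is false as soon as ONE admissible datum exists
(e.g. under `ExistsContinuousLimit`, stmt-4582). Any proof of TT must use `0 < J` or `∀ J' > J, LRO J'` — i.e. that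
`J` is THE ordering threshold, not merely a coupling without plane order. [folklore] -/
theorem twinTransparencyWithoutOrderThreshold_false_of_datum
    (hex : ∃ (ρ : ℝ → ℝ) (S : CorrFamily 3), (∀ δ ∈ Set.Ioc (0:ℝ) 1, 0 < ρ δ) ∧
      HasPointwiseScalingLimit (criticalCorr 3) ρ S ∧ IsNondegenerateTwoPoint S) :
    ¬ TwinTransparencyWithoutOrderThreshold♭ := by
  obtain ⟨ρ, S, hρ, hlim, hnd⟩ := hex
  intro h
  exact conclusion_false_at_seam_zero ρ S hnd (h ρ S hρ hlim hnd 0 ⟨le_rfl, not_LRO_seam_zero⟩)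

/-- The same packaged against the route's existence crux: `ExistsContinuousLimit → ¬ (weakened TT)`. [folklore] -/
theorem twinTransparencyWithoutOrderThreshold_false_of_existsContinuousLimit
    (hE : Summit.CriticalPhenomena.Ising3DConformalLimit.Theses.ReflectionTwin.ExistsContinuousLimit) :
    ¬ TwinTransparencyWithoutOrderThreshold♭ := by
  obtain ⟨ρ, Δ, S, hρ, -, hlim, -, -, hnd, -, -⟩ := hE
  exact twinTransparencyWithoutOrderThreshold_false_of_datum ⟨ρ, S, hρ, hlim, hnd⟩

end Summit.CriticalPhenomena.Ising3DConformalLimit.Theorems.TwinTransparency.Negative
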